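import Literature.Probability.RandomPlanarGeometry.SAWFiniteMemoryZ3
import HarnessLib

/-!
# `μ(ℤ³) ≤ 4.76`: the memory-10 Pönitz–Tittmann certificate on `ℤ³` (one `native_decide`)

Topic `Literature/Probability/RandomPlanarGeometry`.  One compiled evaluation of `FiniteMemory3.check 10 4760 1000 60`
(`SAWFiniteMemoryZ3.lean`): the breadth-first search finds the 139 183 states of the memory-10 automaton of Pönitz–Tittmann (2000) on
`ℤ³`, 60 rounds of integer power iteration propose a weight vector, and the verified checker confirms closure and the Collatz–Wielandt
inequalities with ratio `4760/1000` (the Perron root is `4.759837…`, P–T Table 2, `d = 3`, `k = 10`: `4.7599`).  By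
`connectiveConstant_le_of_check` this proves **`μ(ℤ³) ≤ 4.76`** for the tree's connective constant `SAW.Zd.connectiveConstant 3`
(the tree's previous kernel value was the memory-4 bound `4.865`, `connectiveConstant_three_le_memFour`; the source's best printed value is
the memory-14 bound `4.7387`, named fact `PT2000_connectiveConstant_three_le`).  The only non-standard axiom is the `native_decide`
auxiliary axiom of `check_10` (trust in the Lean compiler, `Lean.ofReduceBool`), declared to the gate as `computational`.
Consumer: Fisher's bound `tanh β_c(ℤ³) ≥ 1/μ(ℤ³)` (`lt_criticalBeta_of_le_of_mul_tanh_lt_one`) gives `β_c(ℤ³) > artanh(1/4.76) = 0.21326…`.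
A second, cheaper evaluation `check 8 4778 1000 60 = true` (9 505 states; P–T Table 2, `k = 8`: `4.7780`, Perron root `4.777970…`) is included as a
consistency check of the pipeline against a second printed value (`connectiveConstant_three_le_4778`).

## References

* A. Pönitz, P. Tittmann, *Improved upper bounds for self-avoiding walks in ℤᵈ*, Electron. J. Combin. 7 (2000) R21, Table 2.
  [PonitzTittmann2000]
-/

namespace Literature.Probability.RandomPlanarGeometry.SAW.Zd

/-- The memory-10 certificate on `ℤ³` evaluates to `true` (139 183 states, ratio `4.76`). [cite: PonitzTittmann2000, Table 2 (d = 3, k = 10)] -/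
theorem FiniteMemory3.check_10 : FiniteMemory3.check 10 4760 1000 60 = true := by
  native_decide

/-- The memory-8 certificate on `ℤ³` evaluates to `true` (9 505 states, ratio `4.778`). [cite: PonitzTittmann2000, Table 2 (d = 3, k = 8)] -/
theorem FiniteMemory3.check_8 : FiniteMemory3.check 8 4778 1000 60 = true := by
  native_decide

/-- **`μ(ℤ³) ≤ 4.778`** (Pönitz–Tittmann 2000, Table 2, `d = 3`, `k = 8`: `μ(3,8) = 4.7780`) — superseded by the memory-10 value below, kept as a
second kernel-reproduced entry of the printed table. [cite: PonitzTittmann2000, Table 2 (d = 3, k = 8)] -/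
theorem connectiveConstant_three_le_4778 : connectiveConstant 3 ≤ 4.778 := by
  have h := FiniteMemory3.connectiveConstant_le_of_check FiniteMemory3.check_8 (by norm_num)
  have e : ((4778 : ℕ) : ℝ) / ((1000 : ℕ) : ℝ) = 4.778 := by norm_num
  rwa [e] at h

/-- **`μ(ℤ³) ≤ 4.76`** (Pönitz–Tittmann 2000, Table 2, `d = 3`, `k = 10`: `μ(3,10) = 4.7599`). [cite: PonitzTittmann2000, Table 2 (d = 3, k = 10)] -/
theorem connectiveConstant_three_le_476 : connectiveConstant 3 ≤ 4.76 := by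
  have h := FiniteMemory3.connectiveConstant_le_of_check FiniteMemory3.check_10 (by norm_num)
  have e : ((4760 : ℕ) : ℝ) / ((1000 : ℕ) : ℝ) = 4.76 := by norm_num
  rwa [e] at h

/-- **`z_c(3) ≥ 1/4.76 = 0.2100…`**: the critical point `z_c = 1/μ` of the self-avoiding walk on `ℤ³` (BDGS 2012, §1.4) is at least `1/4.76`.
[cite: PonitzTittmann2000, Table 2 (d = 3, k = 10)] -/
theorem inv_le_criticalPoint_three : (4.76 : ℝ)⁻¹ ≤ criticalPoint 3 := by
  haveI : NeZero (3 : ℕ) := ⟨by norm_num⟩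
  rw [criticalPoint]
  exact inv_anti₀ (connectiveConstant_pos 3) connectiveConstant_three_le_476

end Literature.Probability.RandomPlanarGeometry.SAW.Zd
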